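import Mathlib
import Summits.Ventures.PercRepro2.Defs
import Summits.Ventures.PercRepro2.Independence
import Summits.Ventures.PercRepro2.Harris
import Summits.Ventures.PercRepro2.Graph
import Summits.Ventures.PercRepro2.Exploration
import Summits.Ventures.PercRepro2.Events
import Summits.Ventures.PercRepro2.FourFunctions
import Summits.Ventures.PercRepro2.Induced
import Summits.Ventures.PercRepro2.Frontier
import Summits.Ventures.PercRepro2.ObsIndependence
import Summits.Ventures.PercRepro2.BHK
import Summits.Ventures.PercRepro2.BHKEvents
import Summits.Ventures.PercRepro2.VdBKahn
import Summits.Ventures.PercRepro2.BHKAvoid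
import Summits.Ventures.PercRepro2.OrderPreservation
import Summits.Ventures.PercRepro2.OrderPreservationDual
import Summits.Ventures.PercRepro2.R2PrimeThreeReduction
import Summits.Ventures.PercRepro2.YBridge
import Summits.Ventures.PercRepro2.Yu1Functionals
import Summits.Ventures.PercRepro2.Yu1Events
import Summits.Ventures.PercRepro2.Yu1
import Summits.Ventures.PercRepro2.YDeltaTools

/-!
# (Yu1Δ) in the regime `P(PD) ≤ M₂ + Δ_T` (blind cell PercRepro2, p1)

Light-first exploration `S = C(a₁)` on `R = {a₂, a₃ ∉ S}` with the functionals of `Yu1Functionals`: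
`u(S) = P_{G∖S}(a₃ ∉ C(a₂))` (increasing), `β(S) = P_{G∖S}(b ∈ C(a₂))` (decreasing, `0` on `b ∈ S`),
`ψ(S) := β(S) − 1{b ∈ S}·(1 − u(S))`. The conjecture (Yu1Δ) (CONJECTURES row 2′Y1Δ,
`proofs/LEAD-PROOFSHAPES.md` §8.9 ADDENDUM 12 (2)) reads `E[1_o ψ; R] · P(PD) ≤ E[1_o u; R] · W`
with `W = M₂ + Δ_T = E[ψ; R]`.

**Theorem (`yu1Delta_of_regime`)**: it holds whenever `P(PD) ≤ W`. Proof: the multiplier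
`g := P(PD)·ψ − W·u` is ANTITONE on all vertex sets when `W ≥ P(PD)` (on `{b ∉ S}` both terms
decrease; on `{b ∈ S}` it is `−P(PD) + (P(PD) − W)·u`, decreasing since `u` increases; across the
jump `b ∉ S ⊆ S' ∋ b` it drops from `≥ −W` to `≤ −W`), and `E[g; R] = 0` by construction; BHK
(`bhk_induced`, `s = a₁`, `X = Y = {a₂, a₃}`, `F₁ = 1{o ∈ ·}`, `F₂ = P(PD) − g` increasing,
nonnegative) gives `E[1_o g; R] ≤ 0`, i.e. the claim. The tower identities of `Yu1` turn the
expectations into the masses `T_{l→h} − Δ_l` and `P(PD, o ∈ C₁)`.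
(The lead's ADDENDUM 12 (2) remark "(Yu1Δ) is BHK 1.3 whenever λ ≥ 1", made exact and landed.)
-/

namespace Summit.Ventures.PercRepro2

open UnionCluster Yu1

section Regime

variable {V : Type*} {E : Type*} [Fintype E] [DecidableEq E] [Fintype V] [DecidableEq V]
  {R : Type*} [Field R] [LinearOrder R] [IsStrictOrderedRing R]

/-- **(Yu1Δ) in the regime `P(PD) ≤ M₂ + Δ_T`** (`b ≠ a₂`): with
`Δ_l = P(C₁ ≠ C₂, o ∈ C₁, a₃ ∈ C₂, b ∈ C₁) − P(C₁ ≠ C₂, o ∈ C₁, a₃ ∈ C₂, b ∈ C₂)`,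
`(T_{l→h} − Δ_l) · P(PD) ≤ P(PD, o ∈ C₁) · (M₂ + Δ_T)`. -/
theorem yu1Delta_of_regime (p : E → R) (hp : IsProbVec p) (ends : E → Sym2 V) {o a₁ a₂ a₃ b : V}
    (hb : b ≠ a₂)
    (hreg : prob p (PDEvent ends a₁ a₂ a₃) ≤ massM2 p ends a₁ a₂ a₃ b + deltaT p ends a₁ a₂ a₃ b) :
    (prob p (PDEvent ends a₁ a₂ a₃ ∩ connEvent ends a₁ o ∩ connEvent ends a₂ b) -
        (prob p ((connEvent ends a₁ a₂)ᶜ ∩ connEvent ends a₁ o ∩ connEvent ends a₂ a₃ ∩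
            connEvent ends a₁ b) -
          prob p ((connEvent ends a₁ a₂)ᶜ ∩ connEvent ends a₁ o ∩ connEvent ends a₂ a₃ ∩
            connEvent ends a₂ b))) * prob p (PDEvent ends a₁ a₂ a₃) ≤
      prob p (PDEvent ends a₁ a₂ a₃ ∩ connEvent ends a₁ o) *
        (massM2 p ends a₁ a₂ a₃ b + deltaT p ends a₁ a₂ a₃ b) := by
  classical
  -- the degenerate case `P(R) = 0`
  rcases (prob_nonneg hp (avoidAll ends a₁ {a₂, a₃})).lt_or_eq with hpos | hzero
  swap
  · have hPD0 : prob p (PDEvent ends a₁ a₂ a₃) = 0 :=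
      le_antisymm (hzero ▸ prob_mono hp (PD_subset_avoid ends a₁ a₂ a₃)) (prob_nonneg hp _)
    have hPDo0 : prob p (PDEvent ends a₁ a₂ a₃ ∩ connEvent ends a₁ o) = 0 :=
      le_antisymm (hPD0 ▸ prob_mono hp Set.inter_subset_left) (prob_nonneg hp _)
    rw [hPD0, hPDo0]
    simp
  -- `W = N_h − r_b`
  have hMΔ : massM2 p ends a₁ a₂ a₃ b + deltaT p ends a₁ a₂ a₃ b =
      prob p (connEvent ends a₂ b ∩ avoidAll ends a₁ {a₂, a₃}) -
        prob p (connEvent ends a₁ b ∩ TEvent ends a₁ a₂ a₃) := by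
    rw [Nh_eq p ends a₁ a₂ a₃ b]
    unfold deltaT
    ring
  -- the left mass: `T_{l→h} − Δ_l = P(o ∈ C₁, b ∈ C₂, R) − P(o, b ∈ C₁, a₃ ∈ C₂, R)`
  have hsplit := prob_inter_add_prob_inter_compl p
    (connEvent ends a₁ o ∩ connEvent ends a₂ b ∩ avoidAll ends a₁ {a₂, a₃}) (connEvent ends a₂ a₃)
  rw [ob_split_eq₁, ob_split_eq₂] at hsplit
  have hL : prob p (PDEvent ends a₁ a₂ a₃ ∩ connEvent ends a₁ o ∩ connEvent ends a₂ b) -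
      (prob p ((connEvent ends a₁ a₂)ᶜ ∩ connEvent ends a₁ o ∩ connEvent ends a₂ a₃ ∩
          connEvent ends a₁ b) -
        prob p ((connEvent ends a₁ a₂)ᶜ ∩ connEvent ends a₁ o ∩ connEvent ends a₂ a₃ ∩
          connEvent ends a₂ b)) =
      prob p (connEvent ends a₁ o ∩ connEvent ends a₂ b ∩ avoidAll ends a₁ {a₂, a₃}) -
        prob p (connEvent ends a₁ o ∩ connEvent ends a₁ b ∩ connEvent ends a₂ a₃ ∩
          avoidAll ends a₁ {a₂, a₃}) := by
    rw [← dl1_event_eq]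
    linarith
  rw [hMΔ] at hreg ⊢
  rw [hL, reg_tower_ob, reg_tower_obT, tower_PD, tower_PDo, tower_N, tower_r]
  rw [tower_PD, tower_N, tower_r] at hreg
  -- abbreviations (pure reals now)
  set Rv : Set (Config E) := avoidAll ends a₁ {a₂, a₃} with hRv
  set A := expect p (fun ω => ind o (cluster ends ω a₁) * beta p ends a₂ b (cluster ends ω a₁) *
    Rv.indicator 1 ω) with hA
  set B := expect p (fun ω => ind o (cluster ends ω a₁) * ind b (cluster ends ω a₁) *
    (1 - u p ends a₂ a₃ (cluster ends ω a₁)) * Rv.indicator 1 ω) with hB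
  set Du := expect p (fun ω => u p ends a₂ a₃ (cluster ends ω a₁) * Rv.indicator 1 ω) with hDu
  set Ou := expect p (fun ω => ind o (cluster ends ω a₁) * u p ends a₂ a₃ (cluster ends ω a₁) *
    Rv.indicator 1 ω) with hOu
  set N := expect p (fun ω => beta p ends a₂ b (cluster ends ω a₁) * Rv.indicator 1 ω) with hN
  set Rb := expect p (fun ω => ind b (cluster ends ω a₁) * (1 - u p ends a₂ a₃ (cluster ends ω a₁)) *
    Rv.indicator 1 ω) with hRb
  -- BHK with `F₁ = 1_o`, `F₂ = Du − g`, `g = Du·ψ − (N − Rb)·u` antitone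
  have hDu0 : 0 ≤ Du := by
    rw [hDu, ← tower_PD]
    exact prob_nonneg hp _
  have hanti := multiplier_antitone p hp ends (a₃ := a₃) hb hDu0 hreg
  set g : Set V → R := fun W => Du * (beta p ends a₂ b W - ind b W * (1 - u p ends a₂ a₃ W)) -
    (N - Rb) * u p ends a₂ a₃ W with hg
  have hF₂ : Monotone (fun W => Du - g W) := fun W W' h => by
    simp only
    linarith [hanti h]
  have hcψ0 : 0 ≤ N - Rb := le_trans hDu0 hreg
  have hF₂0 : ∀ W, 0 ≤ Du - g W := fun W => by
    simp only [hg]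
    have h1 := beta_le_one p hp ends a₂ b W
    have h2 := ind_nonneg (R := R) b W
    have h3 := u_le_one p hp ends a₂ a₃ W
    have h4 := u_nonneg p hp ends a₂ a₃ W
    nlinarith [mul_nonneg h2 (sub_nonneg.2 h3), mul_nonneg hcψ0 h4]
  have key := bhk_induced p hp ends a₁ (ind_mono (R := R) o) hF₂ (ind_nonneg (R := R) o) hF₂0
    Finset.univ {a₂, a₃} {a₂, a₃} (Finset.subset_univ _) (Finset.subset_univ _)
  simp only [Finset.inter_self, Finset.union_self, REvent_univ] at key
  have e : ∀ F : Set V → R, clusterObs ends Finset.univ a₁ F * (avoidAll ends a₁ {a₂, a₃}).indicator 1 =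
      fun ω => F (cluster ends ω a₁) * (avoidAll ends a₁ {a₂, a₃}).indicator 1 ω := by
    intro F
    funext ω
    simp only [Pi.mul_apply, clusterObs_apply, clusterIn_univ]
  rw [e, e, e] at key
  simp only [Pi.mul_apply] at key
  -- the `F₂`-expectations
  have eR : prob p Rv = expect p fun ω => Rv.indicator 1 ω := prob_eq_expect_indicator p _
  have e2 : expect p (fun ω => (Du - g (cluster ends ω a₁)) * Rv.indicator 1 ω) =
      Du * prob p Rv - expect p (fun ω => g (cluster ends ω a₁) * Rv.indicator 1 ω) := by
    rw [eR, ← expect_const_mul, ← expect_sub]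
    congr 1
    funext ω
    simp only [Pi.sub_apply]
    ring
  have e3 : expect p (fun ω => ind o (cluster ends ω a₁) * (Du - g (cluster ends ω a₁)) *
      Rv.indicator 1 ω) =
      Du * expect p (fun ω => ind o (cluster ends ω a₁) * Rv.indicator 1 ω) -
        expect p (fun ω => ind o (cluster ends ω a₁) * g (cluster ends ω a₁) * Rv.indicator 1 ω) := by
    rw [← expect_const_mul, ← expect_sub]
    congr 1
    funext ω
    simp only [Pi.sub_apply]
    ring
  have eg : expect p (fun ω => g (cluster ends ω a₁) * Rv.indicator 1 ω) = 0 := by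
    have : (fun ω => g (cluster ends ω a₁) * Rv.indicator 1 ω) =
        (fun ω => Du * (beta p ends a₂ b (cluster ends ω a₁) * Rv.indicator 1 ω -
          ind b (cluster ends ω a₁) * (1 - u p ends a₂ a₃ (cluster ends ω a₁)) * Rv.indicator 1 ω) -
          (N - Rb) * (u p ends a₂ a₃ (cluster ends ω a₁) * Rv.indicator 1 ω)) := by
      funext ω
      simp only [hg]
      ring
    rw [this, expect_lin, ← hN, ← hRb, ← hDu]
    ring
  have eog : expect p (fun ω => ind o (cluster ends ω a₁) * g (cluster ends ω a₁) *
      Rv.indicator 1 ω) = Du * (A - B) - (N - Rb) * Ou := by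
    have : (fun ω => ind o (cluster ends ω a₁) * g (cluster ends ω a₁) * Rv.indicator 1 ω) =
        (fun ω => Du * (ind o (cluster ends ω a₁) * beta p ends a₂ b (cluster ends ω a₁) *
            Rv.indicator 1 ω -
          ind o (cluster ends ω a₁) * ind b (cluster ends ω a₁) *
            (1 - u p ends a₂ a₃ (cluster ends ω a₁)) * Rv.indicator 1 ω) -
          (N - Rb) * (ind o (cluster ends ω a₁) * u p ends a₂ a₃ (cluster ends ω a₁) *
            Rv.indicator 1 ω)) := by
      funext ω
      simp only [hg]
      ring
    rw [this, expect_lin, ← hA, ← hB, ← hOu]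
  rw [e2, e3, eg, sub_zero] at key
  have hkey : expect p (fun ω => ind o (cluster ends ω a₁) * g (cluster ends ω a₁) *
      Rv.indicator 1 ω) * prob p Rv ≤ 0 := by nlinarith [key]
  have h0 : expect p (fun ω => ind o (cluster ends ω a₁) * g (cluster ends ω a₁) *
      Rv.indicator 1 ω) ≤ 0 := nonpos_of_mul_nonpos_left hkey hpos
  rw [eog] at h0
  linarith

/-- **(Yu2Δ) in the regime `P(PD) ≤ M₂ + Δ_T`** (`b ≠ a₁`, labelling `P(a₁ ↔ b) ≤ P(a₂ ↔ b)`):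
with `Δ_h = P(C₁ ≠ C₂, o ∈ C₂, a₃ ∈ C₁, b ∈ C₂) − P(C₁ ≠ C₂, o ∈ C₂, a₃ ∈ C₁, b ∈ C₁)`,
`(T_{h→l} − Δ_h) · P(PD) ≤ P(PD, o ∈ C₂) · (M₂ + Δ_T)`. The heavy-first multiplier
`g = P(PD)·ψ′ − W·u′` has `E[g; R′] = −P(PD)·gap ≤ 0`; the labelling enters only there. -/
theorem yu2Delta_of_regime (p : E → R) (hp : IsProbVec p) (ends : E → Sym2 V) {o a₁ a₂ a₃ b : V}
    (hb : b ≠ a₁) (hord : prob p (connEvent ends a₁ b) ≤ prob p (connEvent ends a₂ b))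
    (hreg : prob p (PDEvent ends a₁ a₂ a₃) ≤ massM2 p ends a₁ a₂ a₃ b + deltaT p ends a₁ a₂ a₃ b) :
    (prob p (PDEvent ends a₁ a₂ a₃ ∩ connEvent ends a₂ o ∩ connEvent ends a₁ b) -
        (prob p ((connEvent ends a₁ a₂)ᶜ ∩ connEvent ends a₂ o ∩ connEvent ends a₁ a₃ ∩
            connEvent ends a₂ b) -
          prob p ((connEvent ends a₁ a₂)ᶜ ∩ connEvent ends a₂ o ∩ connEvent ends a₁ a₃ ∩
            connEvent ends a₁ b))) * prob p (PDEvent ends a₁ a₂ a₃) ≤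
      prob p (PDEvent ends a₁ a₂ a₃ ∩ connEvent ends a₂ o) *
        (massM2 p ends a₁ a₂ a₃ b + deltaT p ends a₁ a₂ a₃ b) := by
  classical
  -- work with the swapped roles: `a₂` explored, avoid set `{a₁, a₃}`
  rw [connEvent_comm ends a₁ a₂, ← PDEvent_symm ends a₁ a₂ a₃]
  rcases (prob_nonneg hp (avoidAll ends a₂ {a₁, a₃})).lt_or_eq with hpos | hzero
  swap
  · have hPD0 : prob p (PDEvent ends a₂ a₁ a₃) = 0 :=
      le_antisymm (hzero ▸ prob_mono hp (PD_subset_avoid ends a₂ a₁ a₃)) (prob_nonneg hp _)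
    have hPDo0 : prob p (PDEvent ends a₂ a₁ a₃ ∩ connEvent ends a₂ o) = 0 :=
      le_antisymm (hPD0 ▸ prob_mono hp Set.inter_subset_left) (prob_nonneg hp _)
    rw [hPD0, hPDo0]
    simp
  -- `W = W_l + gap` with `W_l = E[ψ′; R′]`
  have hMΔ : massM2 p ends a₁ a₂ a₃ b + deltaT p ends a₁ a₂ a₃ b =
      (prob p (connEvent ends a₁ b ∩ avoidAll ends a₂ {a₁, a₃}) -
        prob p (connEvent ends a₂ b ∩ TEvent ends a₂ a₁ a₃)) +
        (prob p (connEvent ends a₂ b) - prob p (connEvent ends a₁ b)) := by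
    rw [← heavy_mass_eq p ends a₁ a₂ a₃ b, Nh_eq p ends a₁ a₂ a₃ b]
    unfold deltaT
    ring
  have hsplit := prob_inter_add_prob_inter_compl p
    (connEvent ends a₂ o ∩ connEvent ends a₁ b ∩ avoidAll ends a₂ {a₁, a₃}) (connEvent ends a₁ a₃)
  rw [ob_split_eq₁, ob_split_eq₂] at hsplit
  have hL : prob p (PDEvent ends a₂ a₁ a₃ ∩ connEvent ends a₂ o ∩ connEvent ends a₁ b) -
      (prob p ((connEvent ends a₂ a₁)ᶜ ∩ connEvent ends a₂ o ∩ connEvent ends a₁ a₃ ∩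
          connEvent ends a₂ b) -
        prob p ((connEvent ends a₂ a₁)ᶜ ∩ connEvent ends a₂ o ∩ connEvent ends a₁ a₃ ∩
          connEvent ends a₁ b)) =
      prob p (connEvent ends a₂ o ∩ connEvent ends a₁ b ∩ avoidAll ends a₂ {a₁, a₃}) -
        prob p (connEvent ends a₂ o ∩ connEvent ends a₂ b ∩ connEvent ends a₁ a₃ ∩
          avoidAll ends a₂ {a₁, a₃}) := by
    rw [← dl1_event_eq]
    linarith
  have hPDs : prob p (PDEvent ends a₁ a₂ a₃) = prob p (PDEvent ends a₂ a₁ a₃) := by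
    rw [PDEvent_symm]
  rw [hMΔ] at hreg ⊢
  rw [hPDs] at hreg
  rw [hL, reg_tower_ob, reg_tower_obT, tower_PD, tower_PDo, tower_N, tower_r]
  rw [tower_PD, tower_N, tower_r] at hreg
  set Rv : Set (Config E) := avoidAll ends a₂ {a₁, a₃} with hRv
  set A := expect p (fun ω => ind o (cluster ends ω a₂) * beta p ends a₁ b (cluster ends ω a₂) *
    Rv.indicator 1 ω) with hA
  set B := expect p (fun ω => ind o (cluster ends ω a₂) * ind b (cluster ends ω a₂) *
    (1 - u p ends a₁ a₃ (cluster ends ω a₂)) * Rv.indicator 1 ω) with hB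
  set Du := expect p (fun ω => u p ends a₁ a₃ (cluster ends ω a₂) * Rv.indicator 1 ω) with hDu
  set Ou := expect p (fun ω => ind o (cluster ends ω a₂) * u p ends a₁ a₃ (cluster ends ω a₂) *
    Rv.indicator 1 ω) with hOu
  set N := expect p (fun ω => beta p ends a₁ b (cluster ends ω a₂) * Rv.indicator 1 ω) with hN
  set Rb := expect p (fun ω => ind b (cluster ends ω a₂) * (1 - u p ends a₁ a₃ (cluster ends ω a₂)) *
    Rv.indicator 1 ω) with hRb
  set gap := prob p (connEvent ends a₂ b) - prob p (connEvent ends a₁ b) with hgap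
  have hgap0 : 0 ≤ gap := by rw [hgap]; linarith
  have hDu0 : 0 ≤ Du := by
    rw [hDu, ← tower_PD]
    exact prob_nonneg hp _
  have hanti := multiplier_antitone p hp ends (a₃ := a₃) hb hDu0 hreg
  set g : Set V → R := fun W => Du * (beta p ends a₁ b W - ind b W * (1 - u p ends a₁ a₃ W)) -
    (N - Rb + gap) * u p ends a₁ a₃ W with hg
  have hF₂ : Monotone (fun W => Du - g W) := fun W W' h => by
    simp only
    linarith [hanti h]
  have hcψ0 : 0 ≤ N - Rb + gap := le_trans hDu0 hreg
  have hF₂0 : ∀ W, 0 ≤ Du - g W := fun W => by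
    simp only [hg]
    have h1 := beta_le_one p hp ends a₁ b W
    have h2 := ind_nonneg (R := R) b W
    have h3 := u_le_one p hp ends a₁ a₃ W
    have h4 := u_nonneg p hp ends a₁ a₃ W
    nlinarith [mul_nonneg h2 (sub_nonneg.2 h3), mul_nonneg hcψ0 h4]
  have key := bhk_induced p hp ends a₂ (ind_mono (R := R) o) hF₂ (ind_nonneg (R := R) o) hF₂0
    Finset.univ {a₁, a₃} {a₁, a₃} (Finset.subset_univ _) (Finset.subset_univ _)
  simp only [Finset.inter_self, Finset.union_self, REvent_univ] at key
  have e : ∀ F : Set V → R, clusterObs ends Finset.univ a₂ F * (avoidAll ends a₂ {a₁, a₃}).indicator 1 =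
      fun ω => F (cluster ends ω a₂) * (avoidAll ends a₂ {a₁, a₃}).indicator 1 ω := by
    intro F
    funext ω
    simp only [Pi.mul_apply, clusterObs_apply, clusterIn_univ]
  rw [e, e, e] at key
  simp only [Pi.mul_apply] at key
  have eR : prob p Rv = expect p fun ω => Rv.indicator 1 ω := prob_eq_expect_indicator p _
  have e2 : expect p (fun ω => (Du - g (cluster ends ω a₂)) * Rv.indicator 1 ω) =
      Du * prob p Rv - expect p (fun ω => g (cluster ends ω a₂) * Rv.indicator 1 ω) := by
    rw [eR, ← expect_const_mul, ← expect_sub]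
    congr 1
    funext ω
    simp only [Pi.sub_apply]
    ring
  have e3 : expect p (fun ω => ind o (cluster ends ω a₂) * (Du - g (cluster ends ω a₂)) *
      Rv.indicator 1 ω) =
      Du * expect p (fun ω => ind o (cluster ends ω a₂) * Rv.indicator 1 ω) -
        expect p (fun ω => ind o (cluster ends ω a₂) * g (cluster ends ω a₂) * Rv.indicator 1 ω) := by
    rw [← expect_const_mul, ← expect_sub]
    congr 1
    funext ω
    simp only [Pi.sub_apply]
    ring
  have eg : expect p (fun ω => g (cluster ends ω a₂) * Rv.indicator 1 ω) = - (Du * gap) := by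
    have : (fun ω => g (cluster ends ω a₂) * Rv.indicator 1 ω) =
        (fun ω => Du * (beta p ends a₁ b (cluster ends ω a₂) * Rv.indicator 1 ω -
          ind b (cluster ends ω a₂) * (1 - u p ends a₁ a₃ (cluster ends ω a₂)) * Rv.indicator 1 ω) -
          (N - Rb + gap) * (u p ends a₁ a₃ (cluster ends ω a₂) * Rv.indicator 1 ω)) := by
      funext ω
      simp only [hg]
      ring
    rw [this, expect_lin, ← hN, ← hRb, ← hDu]
    ring
  have eog : expect p (fun ω => ind o (cluster ends ω a₂) * g (cluster ends ω a₂) *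
      Rv.indicator 1 ω) = Du * (A - B) - (N - Rb + gap) * Ou := by
    have : (fun ω => ind o (cluster ends ω a₂) * g (cluster ends ω a₂) * Rv.indicator 1 ω) =
        (fun ω => Du * (ind o (cluster ends ω a₂) * beta p ends a₁ b (cluster ends ω a₂) *
            Rv.indicator 1 ω -
          ind o (cluster ends ω a₂) * ind b (cluster ends ω a₂) *
            (1 - u p ends a₁ a₃ (cluster ends ω a₂)) * Rv.indicator 1 ω) -
          (N - Rb + gap) * (ind o (cluster ends ω a₂) * u p ends a₁ a₃ (cluster ends ω a₂) *
            Rv.indicator 1 ω)) := by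
      funext ω
      simp only [hg]
      ring
    rw [this, expect_lin, ← hA, ← hB, ← hOu]
  rw [e2, e3, eg] at key
  have hEo : 0 ≤ expect p (fun ω => ind o (cluster ends ω a₂) * Rv.indicator 1 ω) :=
    expect_nonneg hp fun ω => mul_nonneg (ind_nonneg (R := R) o _)
      (Set.indicator_apply_nonneg fun _ => zero_le_one)
  -- `key : E[1_o] (Du P(R) + Du gap) ≤ (Du E[1_o] − E[1_o g]) P(R)` ⇒ `E[1_o g] P(R) ≤ −Du gap E[1_o] ≤ 0`
  have hkey : expect p (fun ω => ind o (cluster ends ω a₂) * g (cluster ends ω a₂) *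
      Rv.indicator 1 ω) * prob p Rv ≤ 0 := by
    nlinarith [key, mul_nonneg (mul_nonneg hDu0 hgap0) hEo]
  have h0 : expect p (fun ω => ind o (cluster ends ω a₂) * g (cluster ends ω a₂) *
      Rv.indicator 1 ω) ≤ 0 := nonpos_of_mul_nonpos_left hkey hpos
  rw [eog] at h0
  linarith

end Regime

end Summit.Ventures.PercRepro2
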